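import Literature.MathematicalPhysics.QuantumFieldTheory.Balaban1983to89.B6Cover236MultiLevelTorusReach

/-!
# `Balaban1983to89.B6Cover236MultiLevelTorusReachBig` — THE FINITE OVERLAP OF THE CUT-OFF SETS `□̃ = QbigT □` OF THE
k-LEVEL PERIODIC PARTITION ON THE TORUS `T_η`: every torus block belongs to at most `3·7^{d+1}` of the sets `□̃`
(v1.1 of `B6Cover236MultiLevelTorusReach`, as a sibling leaf so that no existing module is touched; no fact is minted)

FRAMING (verbatim cell line):
statement-level skeleton of published theorems with citation tags; proofs where landed; nothing here is a claim about the Yang–Mills mass gap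

Source under audit (cell pub-balaban / lit-balaban): T. Bałaban, *Propagators and renormalization transformations for
lattice gauge theories. II*, Commun. Math. Phys. **96** (1984) 223–250 [`Balaban1984PropagatorsII`, "B6"], p. 229 [PDF 7]
((2.36)), p. 235 [PDF 13] («we take a second cube □̃ containing □ in the middle and of the size 4M»), p. 239 [PDF 17]
(«ζ_□ ∈ C₀^∞(□̃)»), p. 247 [PDF 25] ((2.133)–(2.136): the sums over `□ ∈ 𝒟`).  Unit `lit-balaban-p21` (Phase-2 proof
seat p21 gen 18; r03's finding F5 (i), STATUS 2026-08-23T07:38Z), HOME `run/shared/lean/pub/lit-balaban/`, B6 fold owner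
r03, referee ref-4.

## WHAT IS PRINTED (p. 235, p. 239, verbatim up to notation)

p. 235: «we take a second cube □̃ containing □ in the middle and of the size 4M»; p. 239: «the corresponding family of
functions ζ_□ ∈ C₀^∞(□̃)».  The finiteness of the overlap of the cubes `□̃` is used silently in every sum `Σ_{□∈𝒟}` of
§2.B–§2.C ((2.91)–(2.93), (2.133)–(2.136)).

## WHAT THIS FILE CERTIFIES (kernel-checked)

For every nested family `D : TDomains d ℓ M_h k P R` on the torus (`M_h ≥ 2`, `R ≥ 3L`, `P_μ ≥ 4`) and every torus
block `a ∈ 𝔅_T`: **`card_filter_mem_QbigT_le`** — `#{□ ∈ cubes : a ∈ QbigT □} ≤ 3·7^{d+1}`, where `QbigT □`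
(`B6Partition118KLevelTorusCentral.QbigT`, p38) is the set of torus blocks of `□̃` (the blocks within `7S/4` of the
centre of the central cube of `□`'s canonical chart, transported to the torus).  This is the displayed hypothesis
`hNov` (output sets, `Nbig := 3·7^{d+1}`) of r03's corrected assembly skeleton `B6Prop26KLevelSkeletonV2`
(`hNov_SbigT_of_QbigT`).  Route = that of `card_filter_mem_QT_le` with the larger radius: `lev_window3` — for `R ≥ 3L`
a site within `< 3ML^j` of a site of level `j` has level `j − 1 … j + 1` ((2.2) twice, as `Domains.lev_window` with
`2` replaced by `3`); `window_big` — a block of `□̃` has level `j(□) − 1 … j(□) + 1` (its clamp is within `9S/4 < 3S` of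
the witness); `window_and_congr_of_mem_QbigT` — `|x₀_μ − (β_μ + ½)S − N₀_μ·m| ≤ 3S` for the representative site `x₀`
of `a`; `label_window3` — an integer within `3` of a real lies in a window of `7` around its floor; the count.

## HONEST SCOPE

A counting lemma about the cover, not a printed inequality; the constant `3·7^{d+1}` is ours (print: «O(1)»
overlaps).  `M_h ≥ 2`, `R ≥ 3L` (one more `L` than the `□⁺` count, to see the level window from the larger cube),
`P_μ ≥ 4` as in p38's torus partition files.  Nothing is inferred from the manuscript: every step is kernel-checked.
-/

namespace Literature.MathematicalPhysics.QuantumFieldTheory.Balaban1983to89.B6Cover236MultiLevelTorusReachBig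

open Finset
open Literature.MathematicalPhysics.QuantumFieldTheory.Balaban1983to89.B4ContourShift (supNorm)
open Literature.MathematicalPhysics.QuantumFieldTheory.Balaban1983to89.B4Reflection242 (boxDom mem_boxDom blk)
open Literature.MathematicalPhysics.QuantumFieldTheory.Balaban1983to89.B6MultiLevelBoxOperator (Domains N0 bigSide bigSide_eq
  bigSide_succ one_le_bigSide)
open Literature.MathematicalPhysics.QuantumFieldTheory.Balaban1983to89.B6MultiLevelTorusOperator (TDomains tshift)
open Literature.MathematicalPhysics.QuantumFieldTheory.Balaban1983to89.B6Geom246MultiLevelBox (bset blkOf toR cen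
  dist_toR_cen_le lev_eq_of_blkOf_eq supNorm_eq_dist)
open Literature.MathematicalPhysics.QuantumFieldTheory.Balaban1983to89.B6Geom246MultiLevelTorus (blkMap blkMap_blkOf)
open Literature.MathematicalPhysics.QuantumFieldTheory.Balaban1983to89.B6Cover236MultiLevelBlocks (cubes side side_eq side_pos
  ctr proj blkOf_proj wit lev_wit blk_wit dist_proj_le dist_toR_ctr_le)
open Literature.MathematicalPhysics.QuantumFieldTheory.Balaban1983to89.B6Partition118KLevelFineLip (Qbig mem_Qbig)
open Literature.MathematicalPhysics.QuantumFieldTheory.Balaban1983to89.B6Eq238MultiLevelBox (Pj one_le_Pj)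
open Literature.MathematicalPhysics.QuantumFieldTheory.Balaban1983to89.B6Eq238MultiLevelTorus (svec qc N0_eq_mul_Pj)
open Literature.MathematicalPhysics.QuantumFieldTheory.Balaban1983to89.B6Partition118KLevelTorusChart (cT cubesEquiv
  cubesEquiv_apply_val tshift_sub_ctrT label_mem_boxDom)
open Literature.MathematicalPhysics.QuantumFieldTheory.Balaban1983to89.B6Partition118KLevelTorusCentral (Dch σch cc side_cc
  cubesEquiv_cc QbigT level_bounds one_le_of_four_le pow_le_half_bigSide)
open Literature.MathematicalPhysics.QuantumFieldTheory.Balaban1983to89.B6Cover236MultiLevelTorusBlocks (rep blkOf_rep blkMap_fst)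
open Literature.MathematicalPhysics.QuantumFieldTheory.Balaban1983to89.B6Cover236MultiLevelTorusReach (abs_sub_le_of_blkOf_eq)

noncomputable section

variable {d : ℕ} {ℓ Mh k R : ℕ} {P : Fin (d + 1) → ℕ}

/-! ## §1 Arithmetic and the wider level window -/

/-- an integer `t` with `|u − t| ≤ 3` satisfies `⌊u⌋ − 3 ≤ t ≤ ⌊u⌋ + 3`. [folklore] -/
private theorem label_window3 {u : ℝ} {t : ℤ} (h : |u - (t : ℝ)| ≤ 3) : -3 ≤ t - ⌊u⌋ ∧ t - ⌊u⌋ ≤ 3 := by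
  have h1 := Int.floor_le u
  have h2 := Int.lt_floor_add_one u
  rw [abs_le] at h
  obtain ⟨hl, hr⟩ := h
  constructor
  · have : ((⌊u⌋ : ℤ) : ℝ) - 3 ≤ (t : ℝ) := by linarith
    have : ⌊u⌋ - 3 ≤ t := by exact_mod_cast this
    omega
  · by_contra hlt
    have : (⌊u⌋ : ℝ) + 4 ≤ (t : ℝ) := by exact_mod_cast (show ⌊u⌋ + 4 ≤ t by omega)
    linarith

/-- **LEVELS SEEN FROM A `j`-CUBE, WIDER**: for `R ≥ 3L`, a site within sup-distance `< 3ML^j` of a site of level `j`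
has level `j − 1`, `j` or `j + 1` ((2.2) at the levels `j − 1` and `j + 1`, as `Domains.lev_window` with `3` for `2`).
[cite: Balaban1984PropagatorsII, (2.2) p.224 with p.235 («□̃ … of the size 4M»)] -/
theorem lev_window3 (D : Domains d ℓ Mh k P R) (hR : 3 * (ℓ + 1) ≤ R) {t x : Fin (d + 1) → ℤ}
    (ht : t ∈ boxDom (N0 ℓ Mh k P)) (hx : x ∈ boxDom (N0 ℓ Mh k P)) {j : ℕ} (htj : D.lev t = j)
    (hxt : supNorm (x - t) < 3 * (bigSide ℓ Mh j : ℝ)) : j ≤ D.lev x + 1 ∧ D.lev x ≤ j + 1 := by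
  have hL1 : (1 : ℝ) ≤ (ℓ : ℝ) + 1 := by
    have : (0 : ℝ) ≤ ℓ := by positivity
    linarith
  have hR' : (3 : ℝ) * ((ℓ : ℝ) + 1) ≤ R := by exact_mod_cast hR
  have hR3 : (3 : ℝ) ≤ R := by nlinarith
  have hbs : ∀ i : ℕ, (0 : ℝ) ≤ (bigSide ℓ Mh i : ℝ) := fun i => by positivity
  constructor
  · by_contra hlt
    push Not at hlt
    have hj1 : 1 ≤ j := by rw [← htj]; exact D.one_le_lev t
    obtain ⟨i, rfl⟩ : ∃ i, j = i + 1 := ⟨j - 1, by omega⟩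
    have hsep := D.sep i x hx t ht (by omega) (by omega)
    have e : (bigSide ℓ Mh (i + 1) : ℝ) = ((ℓ : ℝ) + 1) * bigSide ℓ Mh i := by
      rw [bigSide_succ]; push_cast; ring
    rw [e] at hxt
    have h1 : ((R * bigSide ℓ Mh i : ℕ) : ℝ) = (R : ℝ) * bigSide ℓ Mh i := by push_cast; ring
    rw [h1] at hsep
    nlinarith [hbs i]
  · by_contra hlt
    push Not at hlt
    have hsep := D.sep (j + 1) t ht x hx (by omega) (by omega)
    have e : (bigSide ℓ Mh (j + 1) : ℝ) = ((ℓ : ℝ) + 1) * bigSide ℓ Mh j := by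
      rw [bigSide_succ]; push_cast; ring
    have h1 : ((R * bigSide ℓ Mh (j + 1) : ℕ) : ℝ) = (R : ℝ) * (((ℓ : ℝ) + 1) * bigSide ℓ Mh j) := by
      rw [← e]; push_cast; ring
    rw [h1] at hsep
    have hsym : supNorm (t - x) = supNorm (x - t) := by
      rw [← B4TorusKernel.supNorm_neg, neg_sub]
    rw [hsym] at hsep
    nlinarith [hbs j]

/-! ## §2 One cube: the level window and the label congruence of a cut-off set containing a block -/

section Reach

variable (D : TDomains d ℓ Mh k P R)

/-- the clamp of the witness into a block of `□̃` is within `< 3S` of the witness (`7S/4 + S/2`).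
[cite: Balaban1984PropagatorsII, (2.2) p.224 with p.235, bookkeeping] -/
theorem supNorm_proj_wit_lt_big (D' : Domains d ℓ Mh k P R) (hMh : 1 ≤ Mh) {i : ↥(cubes D')} {y : ↥(bset D')}
    (hy : y ∈ Qbig D' i) : supNorm ((proj D' y (wit D' i).1).1 - (wit D' i).1) < 3 * (bigSide ℓ Mh i.1.1 : ℝ) := by
  have hS := side_pos D' hMh i
  rw [supNorm_eq_dist]
  calc dist (toR (proj D' y (wit D' i).1).1) (toR (wit D' i).1) ≤ dist (cen D' y) (toR (wit D' i).1) := dist_proj_le D' y _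
    _ ≤ dist (cen D' y) (ctr D' i) + dist (toR (wit D' i).1) (ctr D' i) := dist_triangle_right _ _ _
    _ ≤ 7 / 4 * side D' i + side D' i / 2 := add_le_add ((mem_Qbig D').1 hy) (dist_toR_ctr_le D' hMh (blk_wit D' i))
    _ < 3 * (bigSide ℓ Mh i.1.1 : ℝ) := by show _ < 3 * side D' i; linarith

/-- **THE WINDOW OF `□̃`**: every block of the cut-off cube of a level-`j` active big block has level `j − 1`, `j` or
`j + 1` (`R ≥ 3L`). [cite: Balaban1984PropagatorsII, (2.2) p.224 with p.235 («either □̃ ⊂ B^j(Λ_j), or it intersects B^{j+1}(Λ_{j+1}) also»)] -/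
theorem window_big (D' : Domains d ℓ Mh k P R) (hMh : 1 ≤ Mh) (hR : 3 * (ℓ + 1) ≤ R) {i : ↥(cubes D')} {y : ↥(bset D')}
    (hy : y ∈ Qbig D' i) : i.1.1 ≤ y.1.1 + 1 ∧ y.1.1 ≤ i.1.1 + 1 := by
  have hzl : D'.lev (proj D' y (wit D' i).1).1 = y.1.1 := lev_eq_of_blkOf_eq D' (blkOf_proj D' y _)
  have hw := lev_window3 D' hR (wit D' i).2 (proj D' y (wit D' i).1).2 (lev_wit D' i) (supNorm_proj_wit_lt_big D' hMh hy)
  rw [hzl] at hw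
  exact hw

/-- **A BLOCK OF `□̃` ON THE TORUS: THE LEVEL WINDOW AND THE LABEL CONGRUENCE.**  If the torus block `a` lies in
`QbigT □` of the torus cube `□ = (j, β)`, then `j − 1 ≤ j(a) ≤ j + 1` and, for the representative site `x₀` of `a`, in
every coordinate `|x₀_μ − (β_μ + ½)S_j − N₀_μ·m| ≤ 3S_j` for some integer `m`.
[cite: Balaban1984PropagatorsII, (2.36) p.229, p.235, p.239 (□̃), dictionary (charts)] -/
theorem window_and_congr_of_mem_QbigT (hMh : 2 ≤ Mh) (hR : 3 * (ℓ + 1) ≤ R) (hMh1 : 1 ≤ Mh) (hP4 : ∀ μ, 4 ≤ P μ)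
    {c : ↥(cubes D.toDomains)} {a : ↥(bset D.toDomains)} (ha : a ∈ QbigT D hMh1 hP4 c) :
    (c.1.1 ≤ a.1.1 + 1 ∧ a.1.1 ≤ c.1.1 + 1) ∧
    ∀ μ : Fin (d + 1), ∃ m : ℤ, |((rep D.toDomains a).1 μ : ℝ) - ((c.1.2 μ : ℝ) + 1 / 2) * (bigSide ℓ Mh c.1.1 : ℝ) -
      (N0 ℓ Mh k P μ : ℝ) * m| ≤ 3 * (bigSide ℓ Mh c.1.1 : ℝ) := by
  have hP : ∀ μ, 1 ≤ P μ := one_le_of_four_le hP4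
  unfold QbigT at ha
  rw [Finset.mem_image] at ha
  obtain ⟨b, hb, hba⟩ := ha
  -- the level window in the chart
  have hw := window_big (Dch D c) hMh1 hR hb
  have ecc1 : (cc D hMh1 hP4 c).1.1 = c.1.1 := rfl
  rw [ecc1] at hw
  have hab : b.1.1 = a.1.1 := by rw [← hba]; exact (blkMap_fst D hMh1 hP c b).symm
  rw [hab] at hw
  refine ⟨hw, fun μ => ?_⟩
  -- a chart site of the chart block, within `2S` of the chart centre
  obtain ⟨w, hwdef⟩ : ∃ w : ↥(boxDom (N0 ℓ Mh k P)), w = proj (Dch D c) b 0 := ⟨_, rfl⟩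
  have hwb : blkOf (Dch D c) w = b := by rw [hwdef]; exact blkOf_proj (Dch D c) b 0
  have h1 : dist (toR w.1) (cen (Dch D c) b) ≤ ((((ℓ + 1) ^ b.1.1 : ℕ) : ℝ) - 1) / 2 := dist_toR_cen_le (Dch D c) hwb
  have h2 : dist (cen (Dch D c) b) (ctr (Dch D c) (cc D hMh1 hP4 c)) ≤ 7 / 4 * (bigSide ℓ Mh c.1.1 : ℝ) :=
    (mem_Qbig (Dch D c)).1 hb
  have h3 : (((ℓ + 1) ^ b.1.1 : ℕ) : ℝ) ≤ (bigSide ℓ Mh c.1.1 : ℝ) / 2 :=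
    pow_le_half_bigSide (ℓ := ℓ) hMh (by omega)
  have hwc : |(w.1 μ : ℝ) - ctr (Dch D c) (cc D hMh1 hP4 c) μ| ≤ 2 * (bigSide ℓ Mh c.1.1 : ℝ) := by
    have hμ : dist (toR w.1 μ) (ctr (Dch D c) (cc D hMh1 hP4 c) μ) ≤ dist (toR w.1) (ctr (Dch D c) (cc D hMh1 hP4 c)) :=
      dist_le_pi_dist _ _ μ
    have htri : dist (toR w.1) (ctr (Dch D c) (cc D hMh1 hP4 c)) ≤
        dist (toR w.1) (cen (Dch D c) b) + dist (cen (Dch D c) b) (ctr (Dch D c) (cc D hMh1 hP4 c)) := dist_triangle _ _ _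
    have e : dist (toR w.1 μ) (ctr (Dch D c) (cc D hMh1 hP4 c) μ) = |(w.1 μ : ℝ) - ctr (Dch D c) (cc D hMh1 hP4 c) μ| :=
      Real.dist_eq _ _
    rw [← e]
    linarith
  -- the congruence «torus site − torus centre ≡ chart site − chart centre (mod N₀)»
  have hjk : (cc D hMh1 hP4 c).1.1 ≤ k := (level_bounds D.toDomains c).2
  obtain ⟨m, hm⟩ := tshift_sub_ctrT (svec ℓ k c.1.1 c.1.2) (c := (cc D hMh1 hP4 c).1) hjk w μ
  have hcT : cT ℓ k P (svec ℓ k c.1.1 c.1.2) (cc D hMh1 hP4 c).1 = c.1 := by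
    have h := congrArg Subtype.val (cubesEquiv_cc (D := D) hMh1 hP4 c)
    rwa [cubesEquiv_apply_val] at h
  rw [hcT] at hm
  have ectr : ctr (Dch D c) (cc D hMh1 hP4 c) μ = (((cc D hMh1 hP4 c).1.2 μ : ℝ) + 1 / 2) * (bigSide ℓ Mh c.1.1 : ℝ) := rfl
  rw [ectr] at hwc
  -- the torus site `x = σ_c w` lies in the block `a`
  obtain ⟨x, hxdef⟩ : ∃ x : ↥(boxDom (N0 ℓ Mh k P)), x = σch D c w := ⟨_, rfl⟩
  have hxa : blkOf D.toDomains x = a := by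
    rw [hxdef, ← hba, ← hwb]
    exact (blkMap_blkOf hMh1 hP (svec ℓ k c.1.1 c.1.2) w).symm
  have hm' : (x.1 μ : ℝ) - ((c.1.2 μ : ℝ) + 1 / 2) * (bigSide ℓ Mh c.1.1 : ℝ) =
      ((w.1 μ : ℝ) - (((cc D hMh1 hP4 c).1.2 μ : ℝ) + 1 / 2) * (bigSide ℓ Mh c.1.1 : ℝ)) + (N0 ℓ Mh k P μ : ℝ) * m := by
    rw [hxdef]; exact hm
  -- two sites of `a` differ by less than `L^{j(a)} ≤ S/2`
  have hxx : |(x.1 μ : ℝ) - ((rep D.toDomains a).1 μ : ℝ)| ≤ (((ℓ + 1) ^ a.1.1 : ℕ) : ℝ) - 1 :=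
    abs_sub_le_of_blkOf_eq D.toDomains hxa (blkOf_rep D.toDomains a) μ
  have h4 : (((ℓ + 1) ^ a.1.1 : ℕ) : ℝ) ≤ (bigSide ℓ Mh c.1.1 : ℝ) / 2 := pow_le_half_bigSide (ℓ := ℓ) hMh hw.2
  refine ⟨m, ?_⟩
  rw [abs_le] at hwc hxx ⊢
  obtain ⟨hwc1, hwc2⟩ := hwc
  obtain ⟨hxx1, hxx2⟩ := hxx
  constructor <;> linarith

end Reach

/-! ## §3 The count: at most `3·7^{d+1}` cut-off cubes contain a given torus block -/

section Count

variable (D : TDomains d ℓ Mh k P R)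

/-- **FINITE OVERLAP OF THE CUT-OFF SETS `□̃` ON THE TORUS** (r03's binder `hNov` on the output sets, with
`Nbig = 3·7^{d+1}`): every torus block lies in at most `3·7^{d+1}` of the sets `QbigT □` (three levels, seven labels per
coordinate). [cite: Balaban1984PropagatorsII, (2.36) p.229, p.235 («□̃ … of the size 4M»), p.239, bookkeeping] -/
theorem card_filter_mem_QbigT_le (hMh : 2 ≤ Mh) (hR : 3 * (ℓ + 1) ≤ R) (hMh1 : 1 ≤ Mh) (hP4 : ∀ μ, 4 ≤ P μ)
    (a : ↥(bset D.toDomains)) :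
    #(Finset.univ.filter fun c : ↥(cubes D.toDomains) => a ∈ QbigT D hMh1 hP4 c) ≤ 3 * 7 ^ (d + 1) := by
  classical
  have hP : ∀ μ, 1 ≤ P μ := one_le_of_four_le hP4
  obtain ⟨x₀, hx₀⟩ : ∃ x₀ : ↥(boxDom (N0 ℓ Mh k P)), x₀ = rep D.toDomains a := ⟨_, rfl⟩
  obtain ⟨u, hu⟩ : ∃ u : ℕ → Fin (d + 1) → ℤ,
      u = fun j μ => ⌊(x₀.1 μ : ℝ) / (bigSide ℓ Mh j : ℝ) - 1 / 2⌋ := ⟨_, rfl⟩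
  obtain ⟨T, hT⟩ : ∃ T : Finset (ℕ × (Fin (d + 1) → ℤ)), T = (Finset.Icc (a.1.1 - 1) (a.1.1 + 1)).biUnion
      fun j => (Fintype.piFinset fun _ : Fin (d + 1) => Finset.Icc (-3 : ℤ) 3).image
        fun e => (j, fun μ => (u j μ + e μ) % (Pj ℓ k P j μ : ℤ)) := ⟨_, rfl⟩
  have h7 : #(Finset.Icc (-3 : ℤ) 3) = 7 := by rw [Int.card_Icc]; rfl
  have hT3 : #T ≤ 3 * 7 ^ (d + 1) := by
    rw [hT]
    refine Finset.card_biUnion_le.trans ?_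
    calc ∑ j ∈ Finset.Icc (a.1.1 - 1) (a.1.1 + 1),
          #((Fintype.piFinset fun _ : Fin (d + 1) => Finset.Icc (-3 : ℤ) 3).image
            fun e => (j, fun μ => (u j μ + e μ) % (Pj ℓ k P j μ : ℤ)))
        ≤ ∑ _j ∈ Finset.Icc (a.1.1 - 1) (a.1.1 + 1), 7 ^ (d + 1) := Finset.sum_le_sum fun j _ => by
          refine Finset.card_image_le.trans (le_of_eq ?_)
          rw [Fintype.card_piFinset_const, h7]
      _ = #(Finset.Icc (a.1.1 - 1) (a.1.1 + 1)) * 7 ^ (d + 1) := by rw [Finset.sum_const, smul_eq_mul]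
      _ ≤ 3 * 7 ^ (d + 1) := by rw [Nat.card_Icc]; exact Nat.mul_le_mul_right _ (by omega)
  have hsub : (Finset.univ.filter fun c : ↥(cubes D.toDomains) => a ∈ QbigT D hMh1 hP4 c).map
      ⟨Subtype.val, Subtype.val_injective⟩ ⊆ T := by
    intro cv hc
    rw [Finset.mem_map] at hc
    obtain ⟨c, hc, rfl⟩ := hc
    have ha := (Finset.mem_filter.1 hc).2
    obtain ⟨hwin, hcong⟩ := window_and_congr_of_mem_QbigT D hMh hR hMh1 hP4 ha
    choose m hm using hcong
    have hjk : c.1.1 ≤ k := (level_bounds D.toDomains c).2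
    have hS : 0 < (bigSide ℓ Mh c.1.1 : ℝ) := Nat.cast_pos.2 (one_le_bigSide hMh1 _)
    have hlab := mem_boxDom.1 (label_mem_boxDom D.toDomains hMh1 c.2)
    have hN : ∀ μ, (N0 ℓ Mh k P μ : ℝ) = (bigSide ℓ Mh c.1.1 : ℝ) * (Pj ℓ k P c.1.1 μ : ℝ) := fun μ => by
      rw [N0_eq_mul_Pj hjk μ, bigSide_eq]; push_cast; ring
    -- per coordinate: the label is `⌊x₀_μ/S − ½⌋ + e (mod P_j)` with `|e| ≤ 3`
    have hwin' : ∀ μ, -3 ≤ c.1.2 μ + (Pj ℓ k P c.1.1 μ : ℤ) * m μ - u c.1.1 μ ∧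
        c.1.2 μ + (Pj ℓ k P c.1.1 μ : ℤ) * m μ - u c.1.1 μ ≤ 3 := by
      intro μ
      rw [hu]
      refine label_window3 ?_
      have h := hm μ
      rw [← hx₀, hN μ] at h
      have e : (x₀.1 μ : ℝ) / (bigSide ℓ Mh c.1.1 : ℝ) - 1 / 2 - ((c.1.2 μ + (Pj ℓ k P c.1.1 μ : ℤ) * m μ : ℤ) : ℝ) =
          ((x₀.1 μ : ℝ) - ((c.1.2 μ : ℝ) + 1 / 2) * (bigSide ℓ Mh c.1.1 : ℝ) -
            (bigSide ℓ Mh c.1.1 : ℝ) * (Pj ℓ k P c.1.1 μ : ℝ) * (m μ)) / (bigSide ℓ Mh c.1.1 : ℝ) := by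
        push_cast; field_simp; ring
      rw [e, abs_div, abs_of_pos hS, div_le_iff₀ hS]
      exact h
    rw [hT, Finset.mem_biUnion]
    refine ⟨c.1.1, by rw [Finset.mem_Icc]; omega, ?_⟩
    rw [Finset.mem_image]
    refine ⟨fun μ => c.1.2 μ + (Pj ℓ k P c.1.1 μ : ℤ) * m μ - u c.1.1 μ, ?_, ?_⟩
    · rw [Fintype.mem_piFinset]; intro μ; rw [Finset.mem_Icc]; exact hwin' μ
    · show (c.1.1, fun μ => (u c.1.1 μ + (c.1.2 μ + (Pj ℓ k P c.1.1 μ : ℤ) * m μ - u c.1.1 μ)) % (Pj ℓ k P c.1.1 μ : ℤ))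
        = c.1
      refine Prod.ext rfl (funext fun μ => ?_)
      show (u c.1.1 μ + (c.1.2 μ + (Pj ℓ k P c.1.1 μ : ℤ) * m μ - u c.1.1 μ)) % (Pj ℓ k P c.1.1 μ : ℤ) = c.1.2 μ
      have e : u c.1.1 μ + (c.1.2 μ + (Pj ℓ k P c.1.1 μ : ℤ) * m μ - u c.1.1 μ) =
          c.1.2 μ + (Pj ℓ k P c.1.1 μ : ℤ) * m μ := by ring
      rw [e, Int.add_mul_emod_self_left]
      exact Int.emod_eq_of_lt (hlab μ).1 (hlab μ).2
  calc #(Finset.univ.filter fun c : ↥(cubes D.toDomains) => a ∈ QbigT D hMh1 hP4 c)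
      = #((Finset.univ.filter fun c : ↥(cubes D.toDomains) => a ∈ QbigT D hMh1 hP4 c).map
          ⟨Subtype.val, Subtype.val_injective⟩) := (Finset.card_map _).symm
    _ ≤ #T := Finset.card_le_card hsub
    _ ≤ 3 * 7 ^ (d + 1) := hT3

end Count

end

end Literature.MathematicalPhysics.QuantumFieldTheory.Balaban1983to89.B6Cover236MultiLevelTorusReachBig
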